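import Summits.CriticalPhenomena.PercolationContinuityZ3.Theorems.PercNearOneGluingNoHeavyLowerTailGuardedBlockLonelyRelay
import HarnessLib

/-!
# `NoHeavyLowerTail` (stmt-CriticalPhenomena-4575) — the SHARP (λ-weighted) guarded bounds

The guarded lonely relay lemmas (`Theorems.guardedLonelyRelay`, `Theorems.guardedBlockLonelyRelay`) are stated in
max form.  Their proofs contain the sharper per-block statement that the "sharp route" to the cumulative isolation
lemma needs (crux evidence `CIL.md` v3: the crude max form FAILS to close CIL₂ at `|A| = 5`, the λ-weighted form closes it
numerically in 120/120 exact instances).  This file records the sharp form as theorems: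

* `sharpGuardedBound` — for `x ∈ A`, an increasing guard `Q` on the cluster of `A ∖ x`, `G_x = {o↔x} ∩ D_x ∩ Q`,
  `H_x = D_x ∩ Q`, `M = {A pairwise separated}`:   `μ(M) · μ(G_x) ≤ μ({o ↔ x} ∩ M) · μ(H_x)`,
  i.e. `μ(G_x) ≤ λ_x μ(H_x)` with `λ_x = P(o ↔ x | M)`; and `Σ_{x∈A} μ({o↔x} ∩ M) ≤ μ(M)` (`sum_join_inter_sep_le`), so `Σ_x λ_x ≤ 1`.
* `sharpGuardedBlockBound` — the same for a block `B` of a disjoint family `𝓑` (guard on the cluster of `A ∖ B`,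
  `M_𝓑` = all blocks of `𝓑` separated from their complements): `μ(M_𝓑) μ(G_B) ≤ μ({o ↔ B} ∩ M_𝓑) μ(H_B)`, and
  `Σ_{B∈𝓑} μ({o↔B} ∩ M_𝓑) ≤ μ(M_𝓑)` (`sum_joinBlock_inter_sep_le`).

No new mathematics: Kozma–Nitzan Lemma 1(ii) (set-BHK negative correlation, `GuardedLonelyRelay.negCorr` /
`GuardedBlockLonelyRelay.negCorr`) times Lemma 1(i) (terminal separation), with the degenerate denominators handled.
-/

noncomputable section

namespace Summit.CriticalPhenomena.PercolationContinuityZ3.Theorems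

open scoped BigOperators Classical
open MeasureTheory Set
open Literature.Probability.LatticeModels (prodBernoulli)
open Literature.Probability.Percolation
open BlockLonelyRelay

variable {n : ℕ}

/-- Elementary: from `d·g ≤ e·h` (L1(ii)), `e·m ≤ d·f` (L1(i)), `g ≤ d`, all nonnegative, conclude `m·g ≤ f·h`. -/
theorem sharp_algebra {d g e h m f : ℝ} (hg0 : 0 ≤ g) (hh0 : 0 ≤ h) (hm0 : 0 ≤ m) (hf0 : 0 ≤ f)
    (hgd : g ≤ d) (h1 : d * g ≤ e * h) (h2 : e * m ≤ d * f) : m * g ≤ f * h := by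
  rcases hg0.eq_or_lt with hg | hg
  · rw [← hg, mul_zero]; exact mul_nonneg hf0 hh0
  · have hd : 0 < d := lt_of_lt_of_le hg hgd
    -- `d (m g) = m (d g) ≤ m e h`, and `e m h ≤ d f h`
    have h3 : d * (m * g) ≤ d * (f * h) := by
      calc d * (m * g) = m * (d * g) := by ring
        _ ≤ m * (e * h) := mul_le_mul_of_nonneg_left h1 hm0
        _ = (e * m) * h := by ring
        _ ≤ (d * f) * h := mul_le_mul_of_nonneg_right h2 hh0
        _ = d * (f * h) := by ring
    exact le_of_mul_le_mul_left h3 hd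

/-- **Sharp guarded bound (singleton).**  For `x ∈ A` and an increasing guard `Q` determined by the cluster of
`A ∖ x`: `μ(M) · μ({o↔x} ∩ D_x ∩ Q) ≤ μ({o↔x} ∩ M) · μ(D_x ∩ Q)`, `D_x = {x ↮ A∖x}`, `M = {A pairwise separated}`
— i.e. `μ(G_x) ≤ P(o ↔ x | M) · μ(H_x)`. [cite: KozmaNitzan2024, Lemma 1 (p. 5); VandenbergHaggstromKahn2005, Thms. 1.3, 1.5] -/
theorem sharpGuardedBound (w : Sym2 (Fin n) → unitInterval) (A : Finset (Fin n)) (o : Fin n) {x : Fin n}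
    (hx : x ∈ A) (Q : Set (BondConfig (Fin n))) (G : Set (Sym2 (Fin n)) → ℝ) (hG : Monotone G)
    (hGQ : ∀ ω, G (⋃ t ∈ (↑(A.erase x) : Set (Fin n)), openEdgeCluster ω t) = Q.indicator 1 ω) :
    (prodBernoulli w).real {ω : BondConfig (Fin n) | ∀ a ∈ A, ∀ a' ∈ A, a ≠ a' → ω ∉ openConn a a'} *
        (prodBernoulli w).real (openConn o x ∩ {ω | ∀ t ∈ A.erase x, ω ∉ openConn x t} ∩ Q) ≤
      (prodBernoulli w).real (openConn o x ∩
          {ω : BondConfig (Fin n) | ∀ a ∈ A, ∀ a' ∈ A, a ≠ a' → ω ∉ openConn a a'}) *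
        (prodBernoulli w).real ({ω | ∀ t ∈ A.erase x, ω ∉ openConn x t} ∩ Q) :=
  sharp_algebra measureReal_nonneg measureReal_nonneg measureReal_nonneg measureReal_nonneg
    (measureReal_mono (GuardedLonelyRelay.guarded_subset o x A Q))
    (GuardedLonelyRelay.negCorr w A o x Q G hG hGQ) (GuardedLonelyRelay.termSep w A o hx)

/-- `Σ_{x∈A} μ({o ↔ x} ∩ M) ≤ μ(M)`: under `M` (all relays separated) the events `o ↔ x` are pairwise disjoint, so
`Σ_x P(o ↔ x | M) ≤ 1`. [cite: KozmaNitzan2024, Lemma 2 (p. 6)] -/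
theorem sum_join_inter_sep_le (w : Sym2 (Fin n) → unitInterval) (A : Finset (Fin n)) (o : Fin n) :
    ∑ x ∈ A, (prodBernoulli w).real (openConn o x ∩
        {ω : BondConfig (Fin n) | ∀ a ∈ A, ∀ a' ∈ A, a ≠ a' → ω ∉ openConn a a'}) ≤
      (prodBernoulli w).real {ω : BondConfig (Fin n) | ∀ a ∈ A, ∀ a' ∈ A, a ≠ a' → ω ∉ openConn a a'} := by
  rw [← measureReal_biUnion_finset
    (singleFinger_pairwiseDisjoint_conn_inter_pairSep A A o (Finset.Subset.refl A))
    (fun x _ => MeasurableSet.of_discrete)]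
  exact measureReal_mono (Set.iUnion₂_subset fun x _ => Set.inter_subset_right)

/-- **Sharp guarded bound (block).**  For a family `𝓑` of pairwise disjoint blocks `B ⊆ A`, a block `B ∈ 𝓑` and an
increasing guard `Q` determined by the cluster of `A ∖ B`:
`μ(M_𝓑) · μ({o↔B} ∩ D_B ∩ Q) ≤ μ({o↔B} ∩ M_𝓑) · μ(D_B ∩ Q)`, `M_𝓑` = all blocks of `𝓑` separated from their complements.
[cite: KozmaNitzan2024, Lemma 1 (p. 5); VandenbergHaggstromKahn2005, Thms. 1.3, 1.5] -/
theorem sharpGuardedBlockBound (w : Sym2 (Fin n) → unitInterval) (A : Finset (Fin n)) (o : Fin n)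
    (𝓑 : Finset (Finset (Fin n))) (hsub : ∀ B ∈ 𝓑, B ⊆ A)
    (hdisj : ∀ B' ∈ 𝓑, ∀ B'' ∈ 𝓑, B' ≠ B'' → Disjoint B' B'') {B : Finset (Fin n)} (hB : B ∈ 𝓑)
    (Q : Set (BondConfig (Fin n))) (G : Set (Sym2 (Fin n)) → ℝ) (hG : Monotone G)
    (hGQ : ∀ ω, G (⋃ t ∈ (↑(A \ B) : Set (Fin n)), openEdgeCluster ω t) = Q.indicator 1 ω) :
    (prodBernoulli w).real {ω : BondConfig (Fin n) | ∀ B' ∈ 𝓑, ∀ b ∈ B', ∀ a ∈ A \ B', ω ∉ openConn b a} *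
        (prodBernoulli w).real ({ω | ∃ b ∈ B, ω ∈ openConn o b} ∩
          {ω | ∀ b ∈ B, ∀ a ∈ A \ B, ω ∉ openConn b a} ∩ Q) ≤
      (prodBernoulli w).real ({ω | ∃ b ∈ B, ω ∈ openConn o b} ∩
          {ω : BondConfig (Fin n) | ∀ B' ∈ 𝓑, ∀ b ∈ B', ∀ a ∈ A \ B', ω ∉ openConn b a}) *
        (prodBernoulli w).real ({ω | ∀ b ∈ B, ∀ a ∈ A \ B, ω ∉ openConn b a} ∩ Q) := by
  have hP : ∀ p ∈ (𝓑.erase B).biUnion (fun B' => B' ×ˢ (A \ (B' ∪ B))), p.1 ∈ A \ B := by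
    intro p hp
    obtain ⟨B', hB', hne, h1, _, _, _⟩ := mem_pairs_iff.1 hp
    exact Finset.mem_sdiff.2 ⟨hsub B' hB' h1,
      fun h => (Finset.disjoint_left.1 (hdisj B' hB' B hB hne)) h1 h⟩
  have hsep := blockTerminalSeparation w B (A \ B) o _ hP
  rw [sep_inter_pairs_eq hB hsub hdisj] at hsep
  exact sharp_algebra measureReal_nonneg measureReal_nonneg measureReal_nonneg measureReal_nonneg
    (measureReal_mono (fun ω hω => hω.1.2))
    (GuardedBlockLonelyRelay.negCorr w A B o Q G hG hGQ) hsep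

/-- `Σ_{B∈𝓑} μ({o ↔ B} ∩ M_𝓑) ≤ μ(M_𝓑)`: the events are pairwise disjoint under `M_𝓑`.
[cite: KozmaNitzan2024, Lemma 2 (p. 6)] -/
theorem sum_joinBlock_inter_sep_le (w : Sym2 (Fin n) → unitInterval) (A : Finset (Fin n)) (o : Fin n)
    (𝓑 : Finset (Finset (Fin n))) (hsub : ∀ B ∈ 𝓑, B ⊆ A)
    (hdisj : ∀ B' ∈ 𝓑, ∀ B'' ∈ 𝓑, B' ≠ B'' → Disjoint B' B'') :
    ∑ B ∈ 𝓑, (prodBernoulli w).real ({ω | ∃ b ∈ B, ω ∈ openConn o b} ∩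
        {ω : BondConfig (Fin n) | ∀ B' ∈ 𝓑, ∀ b ∈ B', ∀ a ∈ A \ B', ω ∉ openConn b a}) ≤
      (prodBernoulli w).real {ω : BondConfig (Fin n) | ∀ B' ∈ 𝓑, ∀ b ∈ B', ∀ a ∈ A \ B', ω ∉ openConn b a} := by
  rw [← measureReal_biUnion_finset (pairwiseDisjoint_join_inter 𝓑 o hsub hdisj)
    (fun B _ => MeasurableSet.of_discrete)]
  exact measureReal_mono (Set.iUnion₂_subset fun B _ => Set.inter_subset_right)

end Summit.CriticalPhenomena.PercolationContinuityZ3.Theorems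

end
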